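import Summits.CriticalPhenomena.PercolationContinuityZ3.Theorems.PercNearOneGluingNoHeavyLowerTailSahiSymCubeMemo
import Summits.CriticalPhenomena.PercolationContinuityZ3.Theorems.PercNearOneGluingNoHeavyLowerTailSahiInterpSound
import Summits.CriticalPhenomena.PercolationContinuityZ3.Theorems.PercNearOneGluingNoHeavyLowerTailSahiSymCubeCheck
import Summits.CriticalPhenomena.PercolationContinuityZ3.Theorems.PercNearOneGluingNoHeavyLowerTailSahiCombPositivity

/-!
# The every-order digit tests are COMB certificates: `checkFamW` / `testN` / `testM` / `testI` certify tensor-Bernstein positivity of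
# `p ↦ E_n(μ_p; 1_{A_0}, …, 1_{A_{n−1}})`, not just its sign

Support file (cell `prim-sahi`, seat `prim-sahi-typer` gen 33; `--supports stmt-CriticalPhenomena-4575`).  Pure proofs, no definitions, no
`sorry`, standard axioms.

P3's every-order certificate algebra (…`NCopyCertAlgebra`, …`SahiRecursionCert`) expands, for events `A_i` of the `m`-cube,
`E_n(μ_p; 1_A) = evB n (sahiCoef m n a) p = Σ_K sahiCoef(K) · Π_i p_i^{K_i} (1 − p_i)^{n − K_i}` (`NCopyCert.evB_sahiCoef`) and its digit tests read the
sign of EVERY coefficient `sahiCoef(K)` off one Kronecker number; the landed soundness theorems (`NCopyCert.sahiE_ind_nonneg_of_checkFamW`, typer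
gen 29's `SahiSymCube.testN_sound` / `testM_sound`, gen 30's `SahiInterp.testI_sound`) then drew only the VALUE conclusion `E_n(μ_p; 1_A) ≥ 0`.
The coefficient conclusion is exactly `SahiComb.CombPos (fun _ => n)` (…`SahiCombPositivity`) of `p ↦ E_n(μ_p; 1_A)`:

* `combPos_of_sahiCoef_nonneg` — `sahiCoef ≥ 0` at every key ⟹ comb positivity (the basis `Π bernW` of `evB` IS `SahiComb.bern (fun _ => n)`);
* `combPos_of_checkFamW`, `combPos_of_testN`, `combPos_of_testM`, `combPos_of_testI` — the four digit tests as comb certificates (proofs = the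
  landed value-level proofs up to their last line).
Consumer: …`SahiSymCubeCombSound` / …`SahiCombCubeFiveAllOrders` (this generation): the symmetry-reduced checks of typer gens 29–30 on five letters,
read at comb level, give (M⁺-n) for every `n` on every ground set of size `≤ 5`. [this work]
-/

namespace Summit.CriticalPhenomena.PercolationContinuityZ3.Theorems

open Finset Function
open Literature.Combinatorics.Sahi2008
open Literature.Probability.Percolation.DecisionTree (ind)
open SahiComb OneCutCert CovTransferCert SahiC3Cube

namespace NCopyCert

open scoped Classical

variable {m : ℕ}

/-- **Nonnegative recursion coefficients are a comb certificate**: if `sahiCoef m n a K ≥ 0` for every key `K` (`a` = the bitmasks of the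
events `A_i`), then `p ↦ E_n(μ_p; 1_{A_0}, …, 1_{A_{n−1}})` is comb-positive of multidegree `n` (`evB_sahiCoef`; the two tensor-Bernstein bases
agree key by key). [this work] -/
theorem combPos_of_sahiCoef_nonneg {n : ℕ} (A : Fin n → Set (Set (Fin m)))
    (h : ∀ K, 0 ≤ sahiCoef m n (fun i => encA m (A i)) K) :
    CombPos (fun _ : Fin m => n) (fun p => sahiE (bernoulliWeight p) n (fun i => ind (A i))) := by
  refine ⟨fun j => (sahiCoef m n (fun i => encA m (A i)) (fun i => ⟨min (j i) n, by omega⟩) : ℝ),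
    fun j => ?_, fun p => ?_⟩
  · beta_reduce
    exact_mod_cast h _
  beta_reduce
  rw [← evB_sahiCoef p n A]
  unfold evB
  refine sum_nbij' (fun K i => ((K i : Fin (n + 1)) : ℕ)) (fun j i => (⟨min (j i) n, by omega⟩ : Fin (n + 1)))
    (fun K _ => ?_) (fun j _ => mem_univ _) (fun K _ => ?_) (fun j hj => ?_) (fun K _ => ?_)
  · exact mem_box.2 fun i => by have := (K i).2; omega
  · funext i; apply Fin.ext; have := (K i).2; simp only; omega
  · funext i; have := mem_box.1 hj i; simp only; omega
  · have hK : (fun i => (⟨min ((K i : Fin (n + 1)) : ℕ) n, by omega⟩ : Fin (n + 1))) = K := by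
      funext i; apply Fin.ext; have := (K i).2; simp only; omega
    rw [hK]
    rfl

/-- **`checkFamW` is a comb certificate** (every order): under the coefficient bound `coefBound m n < 2^(σ−1)`, a passing digit test of the
bitmasks of `A` makes `p ↦ E_n(μ_p; 1_A)` comb-positive of multidegree `n`. [this work] -/
theorem combPos_of_checkFamW {σ n : ℕ} (hσ : 0 < σ) (hbnd : coefBound m n < 2 ^ (σ - 1))
    {KT : ℕ → ℤ} (hKT : ∀ T, KT T = (krTB σ (n + 1) m T : ℤ)) (A : Fin n → Set (Set (Fin m)))
    (h : checkFamW KT (krTB σ (n + 1) m (fullN m)) (maskN σ ((n + 1) ^ m)) (maskN σ ((n + 1) ^ m)) n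
      (fun i => encA m (A i)) = true) :
    CombPos (fun _ : Fin m => n) (fun p => sahiE (bernoulliWeight p) n (fun i => ind (A i))) := by
  refine combPos_of_sahiCoef_nonneg A ?_
  unfold checkFamW at h
  simp only [Bool.and_eq_true, decide_eq_true_eq] at h
  obtain ⟨hZ, hland⟩ := h
  set c := sahiCoef m n (fun i => encA m (A i)) with hc
  have hB : ∀ k, |c k| < 2 ^ (σ - 1) := fun k =>
    lt_of_le_of_lt (abs_sahiCoef_le n _ k) (by exact_mod_cast hbnd)
  set N : ℕ := (sahiKr KT (krTB σ (n + 1) m (fullN m)) n (fun i => encA m (A i)) + (maskN σ ((n + 1) ^ m) : ℤ)).toNat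
    with hN
  have hNZ : (N : ℤ) = krB (n + 1) (2 ^ σ) n c + ∑ j : Fin ((n + 1) ^ m), (2 : ℤ) ^ (σ - 1) * (2 ^ σ) ^ (j : ℕ) := by
    rw [hN, Int.toNat_of_nonneg hZ, hc, krB_sahiCoef σ (n + 1) hKT, maskN_eq_sum σ hσ,
      Fin.sum_univ_eq_sum_range (fun j => (2 : ℤ) ^ (σ - 1) * (2 ^ σ) ^ j) ((n + 1) ^ m)]
  have hdig : ∀ j : ℕ, j < (n + 1) ^ m → 2 ^ (σ - 1) ≤ digit (2 ^ σ) N j :=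
    digit_ge_of_land σ hσ ((n + 1) ^ m) N hland
  exact coef_nonneg_of_digit_ge hσ hB N hNZ hdig

end NCopyCert

namespace SahiSymCube

open NCopyCert
open scoped Classical

/-- **`testN` is a comb certificate** (typer gen 29's leaf test = `checkFamW` with the coefficient bound folded in). [this work] -/
theorem combPos_of_testN {m n σb : ℕ} (A : Fin n → Set (Set (Fin m))) (h : testN m n σb (fun i => encA m (A i)) = true) :
    CombPos (fun _ : Fin m => n) (fun p => sahiE (bernoulliWeight p) n (fun i => ind (A i))) := by
  unfold testN at h
  simp only [Bool.and_eq_true, decide_eq_true_eq] at h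
  obtain ⟨⟨hσ, hbnd⟩, h⟩ := h
  exact combPos_of_checkFamW hσ hbnd (fun _ => rfl) A h

/-- **`testM` is a comb certificate** (typer gen 29's memoised digit test; `krMemo_init_eq` identifies it with `checkFamW`). [this work] -/
theorem combPos_of_testM {m n σb : ℕ} (A : Fin n → Set (Set (Fin m))) (h : testM m n σb (fun i => encA m (A i)) = true) :
    CombPos (fun _ : Fin m => n) (fun p => sahiE (bernoulliWeight p) n (fun i => ind (A i))) := by
  unfold testM at h
  simp only [Bool.and_eq_true, decide_eq_true_eq] at h
  obtain ⟨⟨hσ, hbnd⟩, hZ, hland⟩ := h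
  have hfull : ∀ i, encA m (A i) &&& fullN m = encA m (A i) := by
    intro i
    refine Nat.eq_of_testBit_eq fun x => ?_
    rw [Nat.testBit_land]
    unfold fullN
    rw [Nat.testBit_two_pow_sub_one]
    by_cases hx : x < 2 ^ m
    · simp [hx]
    · rw [Nat.testBit_lt_two_pow (lt_of_lt_of_le (encA_lt m (A i)) (Nat.pow_le_pow_right (by norm_num) (not_lt.1 hx)))]
      simp
  rw [krMemo_init_eq _ _ n _ hfull] at hZ hland
  refine combPos_of_checkFamW hσ hbnd (fun _ => rfl) A ?_
  unfold checkFamW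
  simp only [Bool.and_eq_true, decide_eq_true_eq]
  exact ⟨hZ, hland⟩

end SahiSymCube

namespace SahiInterp

open NCopyCert
open scoped Classical

/-- **`testI` is a comb certificate** (typer gen 30's interpolation leaf test: it computes the coefficients `sahiCoef` themselves from grid values
and checks their signs, `hγ` of `testI_sound`). [this work] -/
theorem combPos_of_testI {m n : ℕ} {H : Fin (n + 1) → Fin (n + 1) → ℤ} {c : ℤ} (A : Fin n → Set (Set (Fin m)))
    (h : testI m n H c (fun i => encA m (A i)) = true) :
    CombPos (fun _ : Fin m => n) (fun p => sahiE (bernoulliWeight p) n (fun i => ind (A i))) := by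
  refine combPos_of_sahiCoef_nonneg A fun K => ?_
  unfold testI at h
  simp only [Bool.and_eq_true, decide_eq_true_eq] at h
  obtain ⟨⟨⟨⟨hn, hc⟩, hH⟩, hsym⟩, hall⟩ := h
  rw [Array.all_eq_true] at hall
  have hsize := size_transformA n H m (gridArr m n (fun i => encA m (A i)))
  have hK : enc K < (transformA n H m (gridArr m n (fun i => encA m (A i)))).size := by rw [hsize]; exact enc_lt K
  have h1 := hall (enc K) hK
  rw [decide_eq_true_eq] at h1
  have h2 : (transformA n H m (gridArr m n (fun i => encA m (A i)))).getD (enc K) 0 =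
      (transformA n H m (gridArr m n (fun i => encA m (A i))))[enc K] := by
    rw [Array.getD_eq_getD_getElem?, Array.getElem?_eq_getElem hK, Option.getD_some]
  rw [← h2, transformA_gridArr_eq hn hH A hsym K] at h1
  exact (mul_nonneg_iff_of_pos_left (pow_pos hc m)).1 h1

end SahiInterp

end Summit.CriticalPhenomena.PercolationContinuityZ3.Theorems
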